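import Literature.IUT.HodgeArakelov.EtaleThetaDataOfSettingRootHypTransport
import Literature.AnabelianGeometry.EtaleTheta.Discharge.Sec2OrbitEmbeddingAutTransport
import Literature.AnabelianGeometry.EtaleTheta.Discharge.Sec1ThetaCompanionOfAut

/-!
# GAP row G-w5d169-2, ROUTE 2: `hroot` from [EtTh] Prop 2.4 (F-0609) + Cor 2.8 (i) (F-0640) at the §1 model's
# orbit data `ofEmbedding` — the glue (g1)–(g3)

S. Mochizuki, *The étale theta function …*, Publ. RIMS **45** (2009) [EtTh] (refereed): Prop 2.4 p. 38 ("any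
automorphism of `Π^tp_{X̲̲}` … induces isomorphisms compatible with the various natural maps"), Cor 2.8 (i) p. 42
("`γ` preserves the property that `η̲̈^{Θ,l·ℤ×μ₂}` be of standard type — a property that determines this collection of
classes up to multiplication by a root of unity of order `l`"), Thm 1.6 (ii)/(iii) p. 24; [AbsAnab] Lem 1.3.8
(`γ(Δ^tp_X) = Δ^tp_X`). S. Mochizuki, *Inter-universal Teichmüller theory II*, kurims manuscript (Dec. 2020),
Prop 1.4 p. 27 / Prop 3.4 (i) p. 91 [claim: Mochizuki2012, status: disputed] (IUTchII §1 Prop 1.4, kurims p.27).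

abc-iut cell, seat abc-iut-w5-d118 (gen 5); GAP-LEDGER **G-w5d169-2, ROUTE 2** (abc-iut-w4-d041's D-row
2026-08-26T10:28:05Z; abc-iut-L2-lead ROWS #14b R250).  PROOF-ONLY (no definition, no new `Prop` fact): the binder
`hroot` of abc-iut-w5-d169's `EtaleLevels.prop34i_multiradiallyDefined_ofRootHyp` ([IUTchII] Prop 3.4 (i) / Prop 1.4
functoriality of `θ(Π)` for OUTER `α`), through abc-iut-w4-d041's door `rootHyp_of_forall_extends_transport`
(p436936), from:
* (g1) `α ∈ Aut_top(Π^tp_{X̲̲})` read on `Π^tp_{X̲̲} ⊆ Π^tp_C` of abc-iut-L2-t2's `TemperedCoverData T` through the orbit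
  embedding `ι` (binders `hιe : IsOpenEmbedding ε.ι`, `hιX : range ι = Π^tp_X` of `T` — theorems at abc-iut-L2-d3's cover:
  `CLevelData.isOpenEmbedding_inclX`, `temperedCoverData_tp_PiX`), EXTENDED to `Γ ∈ Aut_top(Π^tp_C)` stabilising the
  Prop 2.4 tower by the NAMED FACT F-0609 `TemperedCoverData.Prop24` (hypothesis `h24`), restricted back to
  `γ ∈ Aut_top(Π^tp_X)` (`Thm16i γ` from `Γ(Π^tp_Ÿ) = Π^tp_Ÿ`; theta companion = abc-iut-w5-d072's CONSTRUCTED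
  `ThetaSetting.thetaCompanionOfAut γ` under `γ(Δ^tp_X) = Δ^tp_X`, [AbsAnab] Lem 1.3.8 shape `hΔ`);
* (g2) the NAMED FACT F-0640 `ThetaOrbitData.Cor28_i` at `ofEmbedding ε hC hS` (hypothesis `h28`, with its standing
  hypotheses: standard type `hstd`, `Γ` permutes `Dtau` `hDtau`) UNPACKED by abc-iut-w5-d118's
  `OrbitEmbedding.exists_rep_transport_eq_mul_coboundary_of_cor28_i` (`Sec2OrbitEmbeddingAutTransport`);
* (g3) `ContH1.comap` bookkeeping: the cocycle identity `γ^Θ∘f₀∘γ⁻¹ = f₁·∂d₀` on `Π^tp_Ÿ ∩ Π^tp_{X̲̲}` says the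
  pull-backs to `Π^tp_{Ÿ̲̲} ⊆ Π^tp_{X̲̲}` of `transport c h (η̈^Θ)` and of `conj_{σ₁} η̈^Θ` coincide.
Results: **`extends_transport_eq_conj_of_cor28_i`** (the `hE`-body of p436936, per `α`) and
**`rootHyp_of_cor28_i`** (= `hroot`, every `α`).  RESIDUAL BINDERS OF ROUTE 2 (all BY NAME / print-shaped, none new):
F-0609, F-0640, `IsStandard`, `Dtau`-stability of tower-stabilising `Γ`, `hΔ`, `hq`, `hιe`/`hιX`.
Nothing here asserts anything of [IUTchII]; no side taken on [IUTchIII] Cor. 3.12; typed ≠ proved.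
-/

noncomputable section

open Topology

namespace Literature.IUT.HodgeArakelov

namespace EtaleThetaDataOfSetting

open Literature.AnabelianGeometry.EtaleTheta Literature.AnabelianGeometry.SemiGraphs ThetaCovers
open Literature.AnabelianGeometry.EtaleTheta CohomologySystemOfContH1

universe u

variable {p : ℕ} [Fact p.Prime] {D : Literature.AnabelianGeometry.EtaleTheta.ThetaSetting p}
  {E : D.EtaleThetaData} {l : ℕ} (C : E.DoubleUnderline l) {T : TemperedCoverData.{u} l}
  (ε : C.OrbitEmbedding T)

/-! ### (g1) Restricting/extending topological automorphisms along the open embedding `ι : Π^tp_X ↪ Π^tp_C` -/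

/-- The codomain restriction of an open embedding to an open subspace is an open map. [folklore] -/
private theorem isOpenMap_restrict_of_isOpenEmbedding {X Y : Type*} [TopologicalSpace X] [TopologicalSpace Y]
    {f : X → Y} (hf : IsOpenEmbedding f) {s : Set X} (hs : IsOpen s) {t : Set Y} (h : ∀ x ∈ s, f x ∈ t) :
    IsOpenMap (fun x : s => (⟨f x, h x x.2⟩ : t)) := by
  intro U hU
  obtain ⟨V, hV, rfl⟩ := isOpen_induced_iff.mp hU
  refine isOpen_induced_iff.mpr ⟨f '' (V ∩ s), hf.isOpenMap _ (hV.inter hs), ?_⟩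
  ext y
  constructor
  · rintro ⟨x, ⟨hxV, hxs⟩, hxy⟩
    exact ⟨⟨x, hxs⟩, hxV, Subtype.ext hxy⟩
  · rintro ⟨x, hxV, rfl⟩
    exact ⟨x, ⟨hxV, x.2⟩, rfl⟩

/-- **(g1a) `Π^tp_{X̲̲} ≅ Π^tp_{X̲̲}` of `T` along `ι`**: for `ι` an open embedding, the orbit embedding's identification
`ι(Π^tp_{X̲̲}) = T.tp T.PiXuu` is a topological group isomorphism `↥C.Huu ≃ₜ* ↥(T.tp T.PiXuu)`, `x ↦ ι x`.
[cite: MochizukiEtTh2009, Prop 2.4 p.38] -/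
theorem exists_continuousMulEquiv_Huu (hιe : IsOpenEmbedding ε.ι) :
    ∃ eU : ↥C.Huu ≃ₜ* ↥(T.tp T.PiXuu), ∀ x : ↥C.Huu, ((eU x : ↥(T.tp T.PiXuu)) : T.Gtp) = ε.ι x := by
  have hmem : ∀ x : D.PiTemp, x ∈ C.Huu → ε.ι x ∈ T.tp T.PiXuu := fun x hx => ε.map_Huu.le ⟨x, hx, rfl⟩
  let r : ↥C.Huu →* ↥(T.tp T.PiXuu) := (ε.ι.comp C.Huu.subtype).codRestrict _ fun x => hmem x x.2
  have hr : Function.Bijective r := by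
    refine ⟨fun x y hxy => Subtype.ext (ε.injective_ι (congrArg Subtype.val hxy)), fun y => ?_⟩
    obtain ⟨x, hx, hxy⟩ := Subgroup.mem_map.mp (ε.map_Huu.ge y.2)
    exact ⟨⟨x, hx⟩, Subtype.ext hxy⟩
  have hcont : Continuous r := (hιe.continuous.comp continuous_subtype_val).subtype_mk _
  have hopen : IsOpenMap r := isOpenMap_restrict_of_isOpenEmbedding hιe C.isOpen_Huu hmem
  let e : ↥C.Huu ≃* ↥(T.tp T.PiXuu) := MulEquiv.ofBijective r hr
  exact ⟨{ e with
      continuous_toFun := hcont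
      continuous_invFun := (e.toEquiv.toHomeomorphOfContinuousOpen hcont hopen).symm.continuous },
    fun x => rfl⟩

/-- **(g1b) `Π^tp_X ≅ Π^tp_X` of `T` along `ι`**: with `range ι = T.tp T.PiX`, `ι` is a topological group isomorphism
`Π^tp_X ≃ₜ* ↥(T.tp T.PiX)`. [cite: MochizukiEtTh2009, Prop 2.4 p.38] -/
theorem exists_continuousMulEquiv_PiX (hιe : IsOpenEmbedding ε.ι) (hιX : ε.ι.range = T.tp T.PiX) :
    ∃ eX : D.PiTemp ≃ₜ* ↥(T.tp T.PiX), ∀ x : D.PiTemp, ((eX x : ↥(T.tp T.PiX)) : T.Gtp) = ε.ι x := by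
  have hmem : ∀ x : D.PiTemp, x ∈ (Set.univ : Set D.PiTemp) → ε.ι x ∈ T.tp T.PiX :=
    fun x _ => hιX.le ⟨x, rfl⟩
  let r : D.PiTemp →* ↥(T.tp T.PiX) := ε.ι.codRestrict _ fun x => hmem x trivial
  have hr : Function.Bijective r := by
    refine ⟨fun x y hxy => ε.injective_ι (congrArg Subtype.val hxy), fun y => ?_⟩
    obtain ⟨x, hxy⟩ := hιX.ge y.2
    exact ⟨x, Subtype.ext hxy⟩
  have hcont : Continuous r := hιe.continuous.subtype_mk _
  have hopen' : IsOpenMap (fun x : (Set.univ : Set D.PiTemp) => (⟨ε.ι x, hmem x x.2⟩ : ↥(T.tp T.PiX))) :=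
    isOpenMap_restrict_of_isOpenEmbedding hιe isOpen_univ hmem
  have hopen : IsOpenMap r := by
    intro U hU
    have h := hopen' (Subtype.val ⁻¹' U) (hU.preimage continuous_subtype_val)
    have hEq : (fun x : (Set.univ : Set D.PiTemp) => (⟨ε.ι x, hmem x x.2⟩ : ↥(T.tp T.PiX))) '' (Subtype.val ⁻¹' U) =
        r '' U := by
      ext y; constructor
      · rintro ⟨x, hx, rfl⟩; exact ⟨x.1, hx, rfl⟩
      · rintro ⟨x, hx, rfl⟩; exact ⟨⟨x, trivial⟩, hx, rfl⟩
    rwa [hEq] at h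
  let e : D.PiTemp ≃* ↥(T.tp T.PiX) := MulEquiv.ofBijective r hr
  exact ⟨{ e with
      continuous_toFun := hcont
      continuous_invFun := (e.toEquiv.toHomeomorphOfContinuousOpen hcont hopen).symm.continuous },
    fun x => rfl⟩

/-- **(g1c) Restriction to `Π^tp_X` of an automorphism of `Π^tp_C` stabilising `ι(Π^tp_X)`**: for `Γ ∈ Aut_top(Π^tp_C)` with
`Γ(T.tp T.PiX) = T.tp T.PiX = range ι` there is `γ ∈ Aut_top(Π^tp_X)` with `ι ∘ γ = Γ ∘ ι`.
[cite: MochizukiEtTh2009, Prop 2.4 p.38] -/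
theorem exists_restrict_aut (hιe : IsOpenEmbedding ε.ι) (hιX : ε.ι.range = T.tp T.PiX) (Γ : T.Gtp ≃ₜ* T.Gtp)
    (hX : (T.tp T.PiX).map Γ.toMulEquiv.toMonoidHom = T.tp T.PiX) :
    ∃ γ : D.PiTemp ≃ₜ* D.PiTemp, ∀ g, ε.ι (γ g) = Γ (ε.ι g) := by
  obtain ⟨eX, heX⟩ := exists_continuousMulEquiv_PiX C ε hιe hιX
  have hX' : (T.tp T.PiX).map Γ.symm.toMulEquiv.toMonoidHom = T.tp T.PiX :=
    ThetaSetting.EtaleThetaData.DoubleUnderline.OrbitEmbedding.map_symm_eq_of_map_eq hX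
  let ΓX : ↥(T.tp T.PiX) ≃ₜ* ↥(T.tp T.PiX) :=
    { toFun := fun h => ⟨Γ h, hX.le ⟨h, h.2, rfl⟩⟩
      invFun := fun h => ⟨Γ.symm h, hX'.le ⟨h, h.2, rfl⟩⟩
      left_inv := fun h => Subtype.ext (Γ.symm_apply_apply (h : T.Gtp))
      right_inv := fun h => Subtype.ext (Γ.apply_symm_apply (h : T.Gtp))
      map_mul' := fun a b => Subtype.ext (by simp only [Subgroup.coe_mul, map_mul])
      continuous_toFun := (Γ.continuous.comp continuous_subtype_val).subtype_mk _
      continuous_invFun := (Γ.symm.continuous.comp continuous_subtype_val).subtype_mk _ }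
  have hΓX : ∀ h : ↥(T.tp T.PiX), ((ΓX h : ↥(T.tp T.PiX)) : T.Gtp) = Γ h := fun h => rfl
  have heX' : ∀ y : ↥(T.tp T.PiX), ε.ι (eX.symm y) = (y : T.Gtp) := fun y => by
    rw [← heX, ContinuousMulEquiv.apply_symm_apply]
  refine ⟨eX.trans (ΓX.trans eX.symm), fun g => ?_⟩
  show ε.ι (eX.symm (ΓX (eX g))) = Γ (ε.ι g)
  rw [heX', hΓX, heX]

/-- **(g1) From `α ∈ Aut_top(Π^tp_{X̲̲})` to `(Γ, γ)` by [EtTh] Prop 2.4**: granted the NAMED FACT F-0609 `T.Prop24` (clause for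
`Π^tp_{X̲̲}`), every topological automorphism `α` of `Π^tp_{X̲̲} = C.Huu` is the restriction of some `Γ ∈ Aut_top(Π^tp_C)`
stabilising the Prop 2.4 tower of `T`, which in turn restricts to some `γ ∈ Aut_top(Π^tp_X)` EXTENDING `α`.
[cite: MochizukiEtTh2009, Prop 2.4 p.38] -/
theorem exists_extension_of_prop24 (hιe : IsOpenEmbedding ε.ι) (hιX : ε.ι.range = T.tp T.PiX) (h24 : T.Prop24)
    (α : (Pi C) ≃ₜ* (Pi C)) :
    ∃ (Γ : T.Gtp ≃ₜ* T.Gtp) (γ : D.PiTemp ≃ₜ* D.PiTemp), (∀ S ∈ T.tower, S.map Γ.toMulEquiv.toMonoidHom = S) ∧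
      (∀ g, ε.ι (γ g) = Γ (ε.ι g)) ∧ ∀ x : Pi C, ((α x : Pi C) : D.PiTemp) = γ (x : D.PiTemp) := by
  obtain ⟨eU, heU⟩ := exists_continuousMulEquiv_Huu C ε hιe
  -- `α` transported to `Π^tp_{X̲̲}` of `T`
  let γT : ↥(T.tp T.PiXuu) ≃ₜ* ↥(T.tp T.PiXuu) := eU.symm.trans ((show ↥C.Huu ≃ₜ* ↥C.Huu from α).trans eU)
  obtain ⟨Γ, hΓext, hΓtower⟩ := h24.1 γT
  have hX : (T.tp T.PiX).map Γ.toMulEquiv.toMonoidHom = T.tp T.PiX := hΓtower _ (by simp [TemperedCoverData.tower])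
  obtain ⟨γ, hγ⟩ := exists_restrict_aut C ε hιe hιX Γ hX
  refine ⟨Γ, γ, hΓtower, hγ, fun x => ε.injective_ι ?_⟩
  -- `ι (α x) = Γ (ι x) = ι (γ x)`
  have hx : eU.symm ⟨ε.ι (x : D.PiTemp), ε.map_Huu.le ⟨x, x.2, rfl⟩⟩ = (x : ↥C.Huu) := by
    apply eU.injective
    rw [ContinuousMulEquiv.apply_symm_apply]
    exact Subtype.ext (heU x).symm
  rw [hγ]
  have h1 := hΓext ⟨ε.ι (x : D.PiTemp), ε.map_Huu.le ⟨x, x.2, rfl⟩⟩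
  rw [h1]
  show ε.ι ((α x : Pi C) : D.PiTemp) = ((eU (α (eU.symm ⟨ε.ι (x : D.PiTemp), _⟩)) : ↥(T.tp T.PiXuu)) : T.Gtp)
  rw [hx, heU]

/-- **`Thm16i γ` for the restriction**: if `ι ∘ γ = Γ ∘ ι` and `Γ(Π^tp_Ÿ of T) = Π^tp_Ÿ of T` (`= ι(Π^tp_Ÿ)`), then
`γ(Π^tp_Ÿ) = Π^tp_Ÿ`. [cite: MochizukiEtTh2009, Thm 1.6 (i) p.24] -/
theorem thm16i_of_restrict {Γ : T.Gtp ≃ₜ* T.Gtp} {γ : D.PiTemp ≃ₜ* D.PiTemp} (hγ : ∀ g, ε.ι (γ g) = Γ (ε.ι g))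
    (hY : T.PiYddtp.map Γ.toMulEquiv.toMonoidHom = T.PiYddtp) : ThetaSetting.Thm16i γ := by
  apply Subgroup.map_injective ε.injective_ι
  have hc : ε.ι.comp γ.toMulEquiv.toMonoidHom = Γ.toMulEquiv.toMonoidHom.comp ε.ι := MonoidHom.ext hγ
  show (D.GtpYdd.map γ.toMulEquiv.toMonoidHom).map ε.ι = D.GtpYdd.map ε.ι
  rw [Subgroup.map_map, hc, ← Subgroup.map_map, ε.map_GtpYdd, hY]

/-! ### (g2)+(g3) `hroot` from Cor 2.8 (i) -/

/-- **G-w5d169-2, ROUTE 2 — the `hE`-body of `rootHyp_of_forall_extends_transport`, per `α`**: granted F-0609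
`T.Prop24`, F-0640 `Cor28_i` at `ofEmbedding ε hC hS` with its standing hypotheses (standard type; tower-stabilising
automorphisms of `Π^tp_C` permute `Dtau`), `γ(Δ^tp_X) = Δ^tp_X` for every `γ ∈ Aut_top(Π^tp_X)` ([AbsAnab] Lem 1.3.8
shape) and `toTheta` a quotient map: every `α ∈ Aut_top(Π^tp_{X̲̲})` extends to some `γ ∈ Aut_top(Π^tp_X)` with
`γ(Π^tp_Ÿ) = Π^tp_Ÿ`, a theta companion `c`, and `transport c h (η̈^Θ) = conj_τ (η̈^Θ)` after pull-back to
`Π^tp_{Ÿ̲̲} ⊆ Π^tp_{X̲̲}`, for some `τ ∈ Π^tp_{X̲̲}`. [cite: MochizukiEtTh2009, Cor 2.8(i) p.42] -/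
theorem extends_transport_eq_conj_of_cor28_i [D.GtpYdd.Normal] (hιe : IsOpenEmbedding ε.ι)
    (hιX : ε.ι.range = T.tp T.PiX) (hq : IsQuotientMap D.toTheta) (hC : D.Compat) (hS : D.Sec2Hyps)
    (hΔ : ∀ γ : D.PiTemp ≃ₜ* D.PiTemp, D.DeltaTemp.map γ.toMulEquiv.toMonoidHom = D.DeltaTemp)
    (h24 : T.Prop24) (hstd : (ThetaOrbitData.ofEmbedding ε hC hS).IsStandard)
    (h28 : (ThetaOrbitData.ofEmbedding ε hC hS).Cor28_i)
    (hDtau : ∀ Γ : T.Gtp ≃ₜ* T.Gtp, (∀ S ∈ T.tower, S.map Γ.toMulEquiv.toMonoidHom = S) →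
      ∀ Dt ∈ (ThetaOrbitData.ofEmbedding ε hC hS).Dtau,
        Dt.map Γ.toMulEquiv.toMonoidHom ∈ (ThetaOrbitData.ofEmbedding ε hC hS).Dtau)
    (α : (Pi C) ≃ₜ* (Pi C)) :
    ∃ (γ : D.PiTemp ≃ₜ* D.PiTemp) (_ : ∀ x : Pi C, ((α x : Pi C) : D.PiTemp) = γ (x : D.PiTemp))
      (h : ThetaSetting.Thm16i γ) (c : ThetaSetting.ThetaCompanion γ) (τ : Pi C),
      ContH1.comap D.toTheta D.DeltaTheta C.Huu.subtype continuous_subtype_val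
          (map_subtype_piYdd_inf_le_GtpYdd C ⊤) (ThetaSetting.transport c h E.etaDd) =
        ContH1.comap D.toTheta D.DeltaTheta C.Huu.subtype continuous_subtype_val
          (map_subtype_piYdd_inf_le_GtpYdd C ⊤) (ContH1.conj D.toTheta D.DeltaTheta (τ : D.PiTemp) E.etaDd) := by
  obtain ⟨Γ, γ, hΓtower, hγ, hext⟩ := exists_extension_of_prop24 C ε hιe hιX h24 α
  have hY : T.PiYddtp.map Γ.toMulEquiv.toMonoidHom = T.PiYddtp := hΓtower _ (by simp [TemperedCoverData.tower])
  have h16 : ThetaSetting.Thm16i γ := thm16i_of_restrict C ε hγ hY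
  let c : ThetaSetting.ThetaCompanion γ := D.thetaCompanionOfAut γ (hΔ γ) hq
  obtain ⟨σ₁, hσ₁, f₀, f₁, d₀, hf₀, hf₁, hrel⟩ :=
    ε.exists_rep_transport_eq_mul_coboundary_of_cor28_i hC hS hγ h16 c hΓtower (hDtau Γ hΓtower) hstd h28
  refine ⟨γ, hext, h16, c, ⟨σ₁, hσ₁⟩, ?_⟩
  rw [show ContH1.conj D.toTheta D.DeltaTheta ((⟨σ₁, hσ₁⟩ : Pi C) : D.PiTemp) E.etaDd = ContH1.mk f₁.1 f₁.2
    from hf₁.symm, ← hf₀]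
  change QuotientGroup.mk (ContH1.comapCocycle D.toTheta D.DeltaTheta C.Huu.subtype continuous_subtype_val
      (map_subtype_piYdd_inf_le_GtpYdd C ⊤) (ThetaSetting.transportCocycle c h16 f₀)) =
    QuotientGroup.mk (ContH1.comapCocycle D.toTheta D.DeltaTheta C.Huu.subtype continuous_subtype_val
      (map_subtype_piYdd_inf_le_GtpYdd C ⊤) f₁)
  rw [QuotientGroup.eq]
  refine Subgroup.mem_subgroupOf.mpr ((mem_contCoboundaries_iff _).mpr ⟨d₀⁻¹, ?_⟩)
  funext y
  have hyH : ((y : Pi C) : D.PiTemp) ∈ C.Huu := (y : Pi C).2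
  have hyY : ((y : Pi C) : D.PiTemp) ∈ D.GtpYdd :=
    map_subtype_piYdd_inf_le_GtpYdd C ⊤ ⟨y, y.2, rfl⟩
  have key := hrel ⟨((y : Pi C) : D.PiTemp), hyY⟩ hyH
  show ((ThetaSetting.transportCocycle c h16 f₀).1 ⟨((y : Pi C) : D.PiTemp), hyY⟩)⁻¹ *
      f₁.1 ⟨((y : Pi C) : D.PiTemp), hyY⟩ =
    MulAut.conjNormal (D.toTheta ((y : Pi C) : D.PiTemp)) d₀⁻¹ * d₀⁻¹⁻¹
  rw [key, mul_inv_rev, inv_mul_cancel_right, mul_inv_rev, inv_inv, map_inv]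
  exact IsMulCommutative.is_comm.comm _ _

section Root

variable [(PiYdd C).Normal] [D.GtpYdd.Normal] (hq : IsQuotientMap D.toTheta) {N : ℕ+} (μ : D.CyclotomeMod l N)
  (hC : D.Compat) (hS : D.Sec2Hyps) (h15 : D.Prop15iii E hC) (L : C.CuspLabels) (R : RigidData.{0} N l)
  (hR : R = C.rigidData μ hC hS h15 L) (h218i : R.Cor218_i)

/-- **G-w5d169-2 CLOSED ALONG ROUTE 2 (modulo its named inputs)**: abc-iut-w5-d169's binder `hroot` — «every topological
automorphism `α` of `Π^tp_{X̲̲}` carries the root class `η̲̈^Θ ∈ H¹(Π^tp_{Ÿ̲̲}, l·Δ_Θ)` to a `Π^tp_{X̲̲}`-conjugate of itself up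
to an `l`-torsion class» — from F-0609 `T.Prop24`, F-0640 `Cor28_i` at the §1 model's orbit data (standard type, `Dtau`
permuted), `γ(Δ^tp_X) = Δ^tp_X`, along an orbit embedding that is an open embedding onto `Π^tp_X` of `T`.
[cite: MochizukiEtTh2009, Cor 2.8(i) p.42] -/
theorem rootHyp_of_cor28_i (hιe : IsOpenEmbedding ε.ι) (hιX : ε.ι.range = T.tp T.PiX)
    (hΔ : ∀ γ : D.PiTemp ≃ₜ* D.PiTemp, D.DeltaTemp.map γ.toMulEquiv.toMonoidHom = D.DeltaTemp)
    (h24 : T.Prop24) (hstd : (ThetaOrbitData.ofEmbedding ε hC hS).IsStandard)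
    (h28 : (ThetaOrbitData.ofEmbedding ε hC hS).Cor28_i)
    (hDtau : ∀ Γ : T.Gtp ≃ₜ* T.Gtp, (∀ S ∈ T.tower, S.map Γ.toMulEquiv.toMonoidHom = S) →
      ∀ Dt ∈ (ThetaOrbitData.ofEmbedding ε hC hS).Dtau,
        Dt.map Γ.toMulEquiv.toMonoidHom ∈ (ThetaOrbitData.ofEmbedding ε hC hS).Dtau)
    (α : (Pi C) ≃ₜ* (Pi C)) :
    ∃ τ : Pi C, ∃ e : (coh C).H1 ⊤, l • e = 0 ∧
      autActTopOfCor218i C hq μ hC hS h15 L R hR h218i α (rootTop C) =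
        h1TopConjEquiv (phi C) (D.lDeltaTheta l) (PiYdd C) τ (rootTop C) + e :=
  rootHyp_of_forall_extends_transport C hq μ hC hS h15 L R hR h218i
    (fun α' => extends_transport_eq_conj_of_cor28_i C ε hιe hιX hq hC hS hΔ h24 hstd h28 hDtau α') α

end Root

end EtaleThetaDataOfSetting

end Literature.IUT.HodgeArakelov

end
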